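import Literature.NumberTheory.LFunctions.GallagherShortWindowMeanValue
import Mathlib.Analysis.SpecialFunctions.Integrals.Basic
import HarnessLib

/-!
# Gallagher's lemma for Dirichlet polynomials (multiplicative form), PROVED

Topic `Literature/NumberTheory/LFunctions`.  Everything in this file is PROVED (no named facts).  It is the instance
`ν_n = −log n/(2π)`, `δ = 1/(2πT)` of the general short-window mean-value lemma of `GallagherShortWindowMeanValue.lean`
(Gallagher 1970, Lemma 1; Montgomery 1971, LNM 227, Lemma 1.9):

  `∫_{-T}^{T} |∑_{n ≤ N} a_n n^{-it}|² dt ≤ (π³/2) · T² · ∫_0^∞ |∑_{y < n ≤ e^{1/T} y} a_n|² dy/y`   (`T ≥ 1`; in fact `T > 0`),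

stated (`gallagher_dirichlet`) VERBATIM in the `∃ C`-shape used as the hypothesis `GallagherDirichlet` of the K_B
short-window funder (`Summits/Parity/GeneralizedHardyLittlewood/Theorems/PrimeLevelFamEdgeIdeaDeltasShortWindowDefs.lean`,
critic B's P-B203-1), so that hypothesis is DISCHARGED by `exact gallagher_dirichlet`.  Steps: `n^{-it} = e(ν_n t)`;
the window form at `δ = 1/(2πT)` is `(2π)⁻¹ ∑ Re(a_m ā_n) Δ_{1/T}(log m − log n)` (`tri_mul`); and the `y`-integral of
the squared multiplicative window sums against `dy/y` equals `∑ Re(a_m ā_n) Δ_{1/T}(log m − log n)` because the windows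
of `m` and `n` overlap on `[max(m,n)e^{−1/T}, min(m,n))`, whose `dy/y`-mass is `(1/T − |log m − log n|)₊`
(`integral_normSq_mulWindow`).  Constant: `(π²/(4δ²))·(2π)⁻¹ = π³T²/2`.

## References
* [Gallagher1970] P. X. Gallagher, *A large sieve density estimate near σ = 1*, Invent. Math. 11 (1970), Lemma 1.
* [Montgomery1971] H. L. Montgomery, *Topics in multiplicative number theory*, LNM 227 (1971), Lemma 1.9 / Thm 9.1.
-/

noncomputable section

open Real MeasureTheory Complex Finset Set
open scoped FourierTransform ComplexConjugate

namespace Literature.NumberTheory.LFunctions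

namespace Gallagher

section Dirichlet

/-- Scaling of the triangle: `Δ_{cδ}(cu) = c Δ_δ(u)` for `c ≥ 0`. [cite: Gallagher1970, Lemma 1 (proof step)] -/
theorem tri_mul {c : ℝ} (hc : 0 ≤ c) (δ u : ℝ) : tri (c * δ) (c * u) = c * tri δ u := by
  unfold tri
  rw [abs_mul, abs_of_nonneg hc, ← mul_sub, ← mul_zero c, ← mul_max_of_nonneg _ _ hc, mul_zero]

/-- The `y`-window overlap for the pair `(a, b)`: `{y : y < a ≤ e^{1/T} y ∧ y < b ≤ e^{1/T} y}`. [folklore] -/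
private def ywin (T a b : ℝ) : Set ℝ := Ico (max a b * Real.exp (-(1 / T))) (min a b)

/-- Membership in the `y`-window overlap = both window conditions. [folklore] -/
private theorem mem_ywin_iff {T a b y : ℝ} :
    y ∈ ywin T a b ↔ (y < a ∧ a ≤ Real.exp (1 / T) * y) ∧ (y < b ∧ b ≤ Real.exp (1 / T) * y) := by
  have hE : 0 < Real.exp (1 / T) := Real.exp_pos _
  have key : ∀ z : ℝ, z * Real.exp (-(1 / T)) ≤ y ↔ z ≤ Real.exp (1 / T) * y := by
    intro z
    rw [Real.exp_neg, ← div_eq_mul_inv, div_le_iff₀ hE, mul_comm]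
  simp only [ywin, Set.mem_Ico, lt_min_iff]
  constructor
  · rintro ⟨h1, h2, h3⟩
    have ha : a * Real.exp (-(1 / T)) ≤ y := le_trans (mul_le_mul_of_nonneg_right (le_max_left a b) (Real.exp_pos _).le) h1
    have hb : b * Real.exp (-(1 / T)) ≤ y := le_trans (mul_le_mul_of_nonneg_right (le_max_right a b) (Real.exp_pos _).le) h1
    exact ⟨⟨h2, (key a).mp ha⟩, ⟨h3, (key b).mp hb⟩⟩
  · rintro ⟨⟨h2, ha⟩, ⟨h3, hb⟩⟩
    refine ⟨?_, h2, h3⟩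
    rcases le_total a b with hab | hab
    · rw [max_eq_right hab]; exact (key b).mpr hb
    · rw [max_eq_left hab]; exact (key a).mpr ha

/-- `∫_{ywin} dy/y = Δ_{1/T}(log a − log b)` for `a, b > 0`. [folklore] -/
private theorem setIntegral_inv_ywin {T a b : ℝ} (_hT : 0 < T) (ha : 0 < a) (hb : 0 < b) :
    ∫ y in ywin T a b, y⁻¹ = tri (1 / T) (Real.log a - Real.log b) := by
  -- reduce to `a ≤ b` by symmetry
  wlog hab : a ≤ b generalizing a b
  · have h := this hb ha (le_of_not_ge hab)
    rw [show ywin T a b = ywin T b a by simp [ywin, max_comm, min_comm], h, ← tri_neg]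
    congr 1; ring
  have hmax : max a b = b := max_eq_right hab
  have hmin : min a b = a := min_eq_left hab
  have hlog : |Real.log a - Real.log b| = Real.log b - Real.log a := by
    rw [abs_sub_comm, abs_of_nonneg (sub_nonneg.mpr (Real.log_le_log ha hab))]
  set α := max a b * Real.exp (-(1 / T)) with hαdef
  have hα : 0 < α := by rw [hαdef, hmax]; positivity
  unfold ywin
  rw [← hαdef, hmin]
  by_cases hle : α ≤ a
  · rw [integral_Ico_eq_integral_Ioc, ← intervalIntegral.integral_of_le hle, integral_inv_of_pos hα ha,
      Real.log_div ha.ne' hα.ne', hαdef, hmax, Real.log_mul hb.ne' (Real.exp_pos _).ne', Real.log_exp]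
    rw [tri_of_abs_le, hlog]
    · ring
    · rw [hlog]
      -- from α ≤ a: log b - 1/T ≤ log a
      have h1 : Real.log (b * Real.exp (-(1 / T))) ≤ Real.log a := by
        rw [hαdef, hmax] at hle; exact Real.log_le_log (by positivity) hle
      rw [Real.log_mul hb.ne' (Real.exp_pos _).ne', Real.log_exp] at h1
      linarith
  · have hlt : a < α := lt_of_not_ge hle
    rw [Set.Ico_eq_empty (not_lt.mpr hlt.le), Measure.restrict_empty, integral_zero_measure]
    rw [tri_of_le_abs]
    rw [hlog]
    have h1 : Real.log a < Real.log (b * Real.exp (-(1 / T))) := by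
      rw [hαdef, hmax] at hlt; exact Real.log_lt_log ha hlt
    rw [Real.log_mul hb.ne' (Real.exp_pos _).ne', Real.log_exp] at h1
    linarith

/-- `y⁻¹` is integrable on the `y`-window overlap of a positive real (it stays away from `0`). [folklore] -/
private theorem integrableOn_inv_ywin {T a b : ℝ} (ha : 0 < a) :
    IntegrableOn (fun y : ℝ => y⁻¹) (ywin T a b) := by
  have hα : 0 < max a b * Real.exp (-(1 / T)) := by positivity
  refine (ContinuousOn.integrableOn_Icc ?_).mono_set Ico_subset_Icc_self
  exact continuousOn_inv₀.mono fun y hy => by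
    simp only [Set.mem_compl_iff, Set.mem_singleton_iff]
    exact (lt_of_lt_of_le hα hy.1).ne'

/-- The `y`-window overlap of a positive real lies in `(0, ∞)`. [folklore] -/
private theorem ywin_subset_Ioi {T a b : ℝ} (ha : 0 < a) : ywin T a b ⊆ Ioi 0 := by
  intro y hy
  have hα : 0 < max a b * Real.exp (-(1 / T)) := by positivity
  exact lt_of_lt_of_le hα hy.1

/-- **The `y`-integral of the squared multiplicative window sums** (`n ≥ 1` integers, ratio `e^{1/T}`):
`∫_0^∞ |∑_{y<n≤e^{1/T}y} a_n|² dy/y = ∑_{m,n} Re(a_m ā_n) Δ_{1/T}(log m − log n)`.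
[cite: Gallagher1970, Lemma 1 (proof step)] -/
theorem integral_normSq_mulWindow (N : ℕ) (a : ℕ → ℂ) {T : ℝ} (hT : 0 < T) :
    ∫ y in Set.Ioi (0 : ℝ),
        ‖∑ n ∈ (Finset.Icc 1 N).filter (fun n : ℕ => y < (n : ℝ) ∧ (n : ℝ) ≤ Real.exp (1 / T) * y), a n‖ ^ 2 / y
      = ∑ m ∈ Finset.Icc 1 N, ∑ n ∈ Finset.Icc 1 N,
          (a m * conj (a n)).re * tri (1 / T) (Real.log m - Real.log n) := by
  set s := Finset.Icc 1 N with hsdef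
  have hpos : ∀ n ∈ s, (0 : ℝ) < n := fun n hn => by
    have := (Finset.mem_Icc.mp hn).1; exact_mod_cast this
  have hpt : ∀ y : ℝ,
      ‖∑ n ∈ s.filter (fun n : ℕ => y < (n : ℝ) ∧ (n : ℝ) ≤ Real.exp (1 / T) * y), a n‖ ^ 2 / y
        = ∑ m ∈ s, ∑ n ∈ s, (a m * conj (a n)).re * (ywin T m n).indicator (fun y : ℝ => y⁻¹) y := by
    intro y
    rw [normSq_sum_filter, div_eq_mul_inv, Finset.sum_mul]
    refine Finset.sum_congr rfl fun m _ => ?_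
    rw [Finset.sum_mul]
    refine Finset.sum_congr rfl fun n _ => ?_
    rw [mul_assoc]
    congr 1
    by_cases hy : y ∈ ywin T m n
    · rw [Set.indicator_of_mem hy, if_pos (mem_ywin_iff.mp hy), one_mul]
    · rw [Set.indicator_of_notMem hy, if_neg (fun h => hy (mem_ywin_iff.mpr h)), zero_mul]
  simp_rw [hpt]
  have hterm : ∀ m ∈ s, ∀ n ∈ s, Integrable (fun y : ℝ =>
      (a m * conj (a n)).re * (ywin T m n).indicator (fun y : ℝ => y⁻¹) y) := by
    intro m hm n hn
    exact ((integrableOn_inv_ywin (T := T) (b := (n : ℝ)) (hpos m hm)).integrable_indicator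
      measurableSet_Ico).const_mul _
  rw [integral_finsetSum _ fun m hm => integrable_finsetSum _ fun n hn => (hterm m hm n hn).integrableOn]
  refine Finset.sum_congr rfl fun m hm => ?_
  rw [integral_finsetSum _ fun n hn => (hterm m hm n hn).integrableOn]
  refine Finset.sum_congr rfl fun n hn => ?_
  have hmeas : MeasurableSet (ywin T (m : ℝ) (n : ℝ)) := measurableSet_Ico
  rw [integral_const_mul, setIntegral_indicator hmeas,
    Set.inter_eq_self_of_subset_right (ywin_subset_Ioi (T := T) (b := (n : ℝ)) (hpos m hm)),
    setIntegral_inv_ywin hT (hpos m hm) (hpos n hn)]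

/-- **GALLAGHER'S LEMMA FOR DIRICHLET POLYNOMIALS** (the multiplicative form, windows `(y, e^{1/T} y]`): for every
`T ≥ 1`, `N`, and complex coefficients `a_n`,
`∫_{-T}^{T} |∑_{n≤N} a_n n^{-it}|² dt ≤ (π³/2)·T²·∫_0^∞ |∑_{y<n≤e^{1/T}y} a_n|² dy/y`
(frequencies `ν_n = −log n/(2π)`, `δ = 1/(2πT)` in the general lemma; the statement is the tree's hypothesis shape
`Summit.…PrimeLevelFamEdgeIdeaDeltas.ShortWindow.GallagherDirichlet`, verbatim). [cite: Gallagher1970, Lemma 1 — derivation] -/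
theorem gallagher_dirichlet :
    ∃ C : ℝ, ∀ (N : ℕ) (a : ℕ → ℂ) (T : ℝ), 1 ≤ T →
      ∫ t in (-T)..T, ‖∑ n ∈ Finset.Icc 1 N, a n * (n : ℂ) ^ (-((t : ℂ) * I))‖ ^ 2 ≤
        C * T ^ 2 * ∫ y in Set.Ioi (0 : ℝ),
          ‖∑ n ∈ (Finset.Icc 1 N).filter (fun n : ℕ => y < (n : ℝ) ∧ (n : ℝ) ≤ Real.exp (1 / T) * y),
            a n‖ ^ 2 / y := by
  refine ⟨π ^ 3 / 2, fun N a T hT1 => ?_⟩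
  have hπ : 0 < π := Real.pi_pos
  have hT : 0 < T := by linarith
  set s := Finset.Icc 1 N with hsdef
  set ν : ℕ → ℝ := fun n => -Real.log n / (2 * π) with hνdef
  set δ : ℝ := (2 * π * T)⁻¹ with hδdef
  have hδ : 0 < δ := by positivity
  have hδT : δ * T ≤ 1 / 2 := by
    rw [hδdef]
    have : (2 * π * T)⁻¹ * T = 1 / (2 * π) := by field_simp
    rw [this]
    exact one_div_le_one_div_of_le (by norm_num) (by nlinarith [Real.pi_gt_three])
  have hmain := integral_normSq_trigPoly_le_windowForm s a ν hT hδ hδT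
  have hL : ∫ t in (-T)..T, ‖∑ n ∈ s, a n * (n : ℂ) ^ (-((t : ℂ) * I))‖ ^ 2 =
      ∫ t in (-T)..T, ‖trigPoly s a ν t‖ ^ 2 := by
    refine intervalIntegral.integral_congr fun t _ => ?_
    simp only [trigPoly]
    congr 2
    refine Finset.sum_congr rfl fun n hn => ?_
    have hn : (0 : ℝ) < n := by have := (Finset.mem_Icc.mp hn).1; exact_mod_cast this
    have hn' : (n : ℂ) ≠ 0 := by exact_mod_cast hn.ne'
    congr 1
    rw [Complex.cpow_def_of_ne_zero hn', ← Complex.natCast_log]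
    congr 1
    rw [hνdef]
    push_cast
    field_simp
  have hW : windowForm s a ν δ = (2 * π)⁻¹ *
      ∑ m ∈ s, ∑ n ∈ s, (a m * conj (a n)).re * tri (1 / T) (Real.log m - Real.log n) := by
    rw [windowForm, Finset.mul_sum]
    refine Finset.sum_congr rfl fun m _ => ?_
    rw [Finset.mul_sum]
    refine Finset.sum_congr rfl fun n _ => ?_
    have h1 : δ = (2 * π)⁻¹ * (1 / T) := by rw [hδdef]; field_simp
    have h2 : ν m - ν n = (2 * π)⁻¹ * (-(Real.log m - Real.log n)) := by rw [hνdef]; field_simp; ring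
    rw [h1, h2, tri_mul (by positivity), tri_neg]
    ring
  have hconst : π ^ 2 / (4 * δ ^ 2) * (2 * π)⁻¹ = π ^ 3 / 2 * T ^ 2 := by
    rw [hδdef]; field_simp; ring
  rw [hL]
  calc ∫ t in (-T)..T, ‖trigPoly s a ν t‖ ^ 2 ≤ π ^ 2 / (4 * δ ^ 2) * windowForm s a ν δ := hmain
    _ = π ^ 3 / 2 * T ^ 2 *
        ∑ m ∈ s, ∑ n ∈ s, (a m * conj (a n)).re * tri (1 / T) (Real.log m - Real.log n) := by
        rw [hW, ← mul_assoc, hconst]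
    _ = π ^ 3 / 2 * T ^ 2 * ∫ y in Set.Ioi (0 : ℝ),
          ‖∑ n ∈ s.filter (fun n : ℕ => y < (n : ℝ) ∧ (n : ℝ) ≤ Real.exp (1 / T) * y), a n‖ ^ 2 / y := by
        rw [integral_normSq_mulWindow N a hT]

end Dirichlet

end Gallagher

end Literature.NumberTheory.LFunctions
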